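import Summits.ValiantsHypothesis.ValiantsHypothesis.Theorems.KPlusLogSqLawTropicalBMarkedEdgeCorePairs

/-!
# Route «KPlusLogSqLaw», crux `TropicalB` (stmt-ValiantsHypothesis-19771) — MARKED-EDGE sector, NESTED-TRIANGLE CORE, ALL sizes, part 4:
# TRIANGLE RIGIDITY — the arcs of `σB, σC, σE` carry no fourth cover

HONEST FRAMING.  Helper file (cell `pub-symmetroid`, seat val-sym-trop-p4 (g18), 2026-08-28; `--supports stmt-ValiantsHypothesis-19771 --as
helper`).  Continues parts 1–3 (`…MarkedEdgeCorePairs`, `…CoreZPairs`, `…CoreZUnique`): all-`m` structure of a would-be realisation of the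
nested-triangle core {1,2},{1,3},{2,3},{0,4} (kernel-impossible at m = 6, p664896; located-exact impossible m ≤ 8; OPEN for m ≥ 9).  THIS PART:
the three TRIANGLE covers (patterns {b1,b2}, {b1,b3}, {b2,b3}, slopes 6 < 10 < 12) satisfy the slope domination of the four-bit chain's triple
exchange lemma — in every factorisation of `σB ⊎ σC ⊎ σE` each loop `b1, b2, b3` is used by exactly two factors, so the factor missing `b3` has
slope ≤ 6 and a factor using `b2, b3` has slope ≥ 12 — hence (`FourBit.no_third_cover`) **every cover inside the arcs of `σB, σC, σE` is one of
them**: the triangle is as rigid as a four-bit triple (g16 THEOREM-FOURBIT), for every `m`.  With part 1 (`core_BC/BE/CE_isCycle`) this puts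
the pair `(σB⁻¹σC, σB⁻¹σE)` of relative cycles in the scope of the common-path order of `…MarkedEdgeCommonPath`.  Nothing here proves the
law; nothing concerns `TropicalB` in its window, `WeakLifting`, the doors, `MatrixDescartes` (stmt-ValiantsHypothesis-18050) or VP ≠ VNP.
-/

set_option linter.dupNamespace false
set_option autoImplicit false

namespace Summit.ValiantsHypothesis.ValiantsHypothesis.Theorems.KPlusLogSqLaw
namespace MarkedEdge
namespace Core

open Finset

variable {V : Type*} [Fintype V] [DecidableEq V]

omit [Fintype V] in
/-- multiplicity two: in a pointwise factorisation `[t, x, y] ~ l` with `l.count v = 2`, exactly two of `t, x, y` equal `v`. [folklore] -/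
theorem two_of_three {t x y v : V} {l : List V} (h : List.Perm [t, x, y] l) (hc : l.count v = 2) :
    (t ≠ v ∧ x = v ∧ y = v) ∨ (t = v ∧ x ≠ v ∧ y = v) ∨ (t = v ∧ x = v ∧ y ≠ v) := by
  have hc' := h.count_eq v
  rw [hc] at hc'
  by_cases ht : t = v <;> by_cases hx : x = v <;> by_cases hy : y = v <;> simp [ht, hx, hy] at hc' ⊢

omit [Fintype V] [DecidableEq V] in
/-- multiplicity zero: in a pointwise factorisation `[t, x, y] ~ l` with `v ∉ l`, none of `t, x, y` equals `v`. [folklore] -/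
theorem none_of_three {t x y v : V} {l : List V} (h : List.Perm [t, x, y] l) (hc : v ∉ l) : t ≠ v ∧ x ≠ v ∧ y ≠ v := by
  have hm : v ∉ [t, x, y] := fun hv => hc (h.mem_iff.mp hv)
  simp only [List.mem_cons, List.not_mem_nil, or_false, not_or] at hm
  exact ⟨fun e => hm.1 e.symm, fun e => hm.2.1 e.symm, fun e => hm.2.2 e.symm⟩

section Core

variable (ok : V → V → Prop) (w g : V → V → ℤ) (b : Fin 5 → V)

/-- a cover missing the loops at `b0, b3, b4` has slope at most 6. [folklore] -/
theorem slope_le_six (hb : Function.Injective b)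
    (hoff : ∀ i j, j ≠ i → g i j = 0) (hmark : ∀ l, g (b l) (b l) = (2 : ℤ) ^ (l : ℕ)) (haux : ∀ i, (∀ l, b l ≠ i) → g i i = 0)
    (F : Equiv.Perm V) (h0 : F (b 0) ≠ b 0) (h3 : F (b 3) ≠ b 3) (h4 : F (b 4) ≠ b 4) : (∑ i, g i (F i)) ≤ 6 := by
  rw [slope_eq_sum_marked g b hb hoff hmark haux F, Fin.sum_univ_five]
  by_cases c1 : F (b 1) = b 1 <;> by_cases c2 : F (b 2) = b 2 <;> simp [h0, h3, h4, c1, c2]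

/-- a cover using the loops at `b2, b3` has slope at least 12. [folklore] -/
theorem twelve_le_slope (hb : Function.Injective b)
    (hoff : ∀ i j, j ≠ i → g i j = 0) (hmark : ∀ l, g (b l) (b l) = (2 : ℤ) ^ (l : ℕ)) (haux : ∀ i, (∀ l, b l ≠ i) → g i i = 0)
    (F : Equiv.Perm V) (h2 : F (b 2) = b 2) (h3 : F (b 3) = b 3) : 12 ≤ ∑ i, g i (F i) := by
  rw [slope_eq_sum_marked g b hb hoff hmark haux F, Fin.sum_univ_five]
  by_cases c0 : F (b 0) = b 0 <;> by_cases c1 : F (b 1) = b 1 <;> by_cases c4 : F (b 4) = b 4 <;>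
    simp [h2, h3, c0, c1, c4]

/-- **Slope domination for the triangle.**  In every factorisation `(F₁, F₂, F₃)` of `σB ⊎ σC ⊎ σE`, some factor has slope ≤ 6 and another
has slope ≥ 12 (the six ordered choices of `FourBit.no_third_cover`). [this seat's lemma] -/
theorem triangle_domination (hb : Function.Injective b)
    (hoff : ∀ i j, j ≠ i → g i j = 0) (hmark : ∀ l, g (b l) (b l) = (2 : ℤ) ^ (l : ℕ)) (haux : ∀ i, (∀ l, b l ≠ i) → g i i = 0)
    {σB σC σE : Equiv.Perm V}
    (hB0 : σB (b 0) ≠ b 0) (hB1 : σB (b 1) = b 1) (hB2 : σB (b 2) = b 2) (hB3 : σB (b 3) ≠ b 3) (hB4 : σB (b 4) ≠ b 4)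
    (hC0 : σC (b 0) ≠ b 0) (hC2 : σC (b 2) ≠ b 2) (hC3 : σC (b 3) = b 3) (hC4 : σC (b 4) ≠ b 4)
    (hE0 : σE (b 0) ≠ b 0) (hE1 : σE (b 1) ≠ b 1) (hE2 : σE (b 2) = b 2) (hE3 : σE (b 3) = b 3) (hE4 : σE (b 4) ≠ b 4)
    (F₁ F₂ F₃ : Equiv.Perm V) (hP : ∀ i, List.Perm [F₁ i, F₂ i, F₃ i] [σB i, σC i, σE i]) :
    ((∑ i, g i (F₁ i)) ≤ (∑ i, g i (σB i)) ∧ (∑ i, g i (σE i)) ≤ ∑ i, g i (F₂ i)) ∨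
      ((∑ i, g i (F₁ i)) ≤ (∑ i, g i (σB i)) ∧ (∑ i, g i (σE i)) ≤ ∑ i, g i (F₃ i)) ∨
      ((∑ i, g i (F₂ i)) ≤ (∑ i, g i (σB i)) ∧ (∑ i, g i (σE i)) ≤ ∑ i, g i (F₁ i)) ∨
      ((∑ i, g i (F₂ i)) ≤ (∑ i, g i (σB i)) ∧ (∑ i, g i (σE i)) ≤ ∑ i, g i (F₃ i)) ∨
      ((∑ i, g i (F₃ i)) ≤ (∑ i, g i (σB i)) ∧ (∑ i, g i (σE i)) ≤ ∑ i, g i (F₁ i)) ∨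
      ((∑ i, g i (F₃ i)) ≤ (∑ i, g i (σB i)) ∧ (∑ i, g i (σE i)) ≤ ∑ i, g i (F₂ i)) := by
  rw [slope_B g b hb hoff hmark haux σB hB0 hB1 hB2 hB3 hB4, slope_E g b hb hoff hmark haux σE hE0 hE1 hE2 hE3 hE4]
  -- the loops at `b0`, `b4` are used by no factor; those at `b2`, `b3` by exactly two factors
  obtain ⟨n10, n20, n30⟩ := none_of_three (v := b 0) (hP (b 0)) (by simp [hB0.symm, hC0.symm, hE0.symm])
  obtain ⟨n14, n24, n34⟩ := none_of_three (v := b 4) (hP (b 4)) (by simp [hB4.symm, hC4.symm, hE4.symm])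
  have c3 := two_of_three (v := b 3) (hP (b 3)) (by simp [hB3, hC3, hE3])
  have c2 := two_of_three (v := b 2) (hP (b 2)) (by simp [hB2, hC2, hE2])
  have lo := fun (F : Equiv.Perm V) (h0 : F (b 0) ≠ b 0) (h3 : F (b 3) ≠ b 3) (h4 : F (b 4) ≠ b 4) =>
    slope_le_six g b hb hoff hmark haux F h0 h3 h4
  have hi := fun (F : Equiv.Perm V) (h2 : F (b 2) = b 2) (h3 : F (b 3) = b 3) => twelve_le_slope g b hb hoff hmark haux F h2 h3
  rcases c3 with ⟨x3, y3, z3⟩ | ⟨x3, y3, z3⟩ | ⟨x3, y3, z3⟩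
  · -- `F₁` misses `b3`; `F₂`, `F₃` use it; one of them uses `b2`
    rcases c2 with ⟨-, y2, -⟩ | ⟨-, -, z2⟩ | ⟨-, y2, -⟩
    · exact Or.inl ⟨lo F₁ n10 x3 n14, hi F₂ y2 y3⟩
    · exact Or.inr (Or.inl ⟨lo F₁ n10 x3 n14, hi F₃ z2 z3⟩)
    · exact Or.inl ⟨lo F₁ n10 x3 n14, hi F₂ y2 y3⟩
  · -- `F₂` misses `b3`
    rcases c2 with ⟨-, -, z2⟩ | ⟨x2, -, -⟩ | ⟨x2, -, -⟩
    · exact Or.inr (Or.inr (Or.inr (Or.inl ⟨lo F₂ n20 y3 n24, hi F₃ z2 z3⟩)))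
    · exact Or.inr (Or.inr (Or.inl ⟨lo F₂ n20 y3 n24, hi F₁ x2 x3⟩))
    · exact Or.inr (Or.inr (Or.inl ⟨lo F₂ n20 y3 n24, hi F₁ x2 x3⟩))
  · -- `F₃` misses `b3`
    rcases c2 with ⟨-, y2, -⟩ | ⟨x2, -, -⟩ | ⟨x2, -, -⟩
    · exact Or.inr (Or.inr (Or.inr (Or.inr (Or.inr ⟨lo F₃ n30 z3 n34, hi F₂ y2 y3⟩))))
    · exact Or.inr (Or.inr (Or.inr (Or.inr (Or.inl ⟨lo F₃ n30 z3 n34, hi F₁ x2 x3⟩))))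
    · exact Or.inr (Or.inr (Or.inr (Or.inr (Or.inl ⟨lo F₃ n30 z3 n34, hi F₁ x2 x3⟩))))

/-- **TRIANGLE RIGIDITY (no fourth cover).**  In any realisation of the core (any finite `V`), every cover whose arcs are arcs of `σB`, `σC`
or `σE` is `σB`, `σC` or `σE` (the hypothesis `σC (b 1) = b 1` of the pattern is not even needed). [this seat's lemma, via
`FourBit.no_third_cover`] -/
theorem core_BCE_rigid (hb : Function.Injective b)
    (hoff : ∀ i j, j ≠ i → g i j = 0) (hmark : ∀ l, g (b l) (b l) = (2 : ℤ) ^ (l : ℕ)) (haux : ∀ i, (∀ l, b l ≠ i) → g i i = 0)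
    {θB θC θE : ℤ} {σB σC σE : Equiv.Perm V} (hBC : θB < θC) (hCE : θC < θE)
    (hB : (∀ i, ok i (σB i)) ∧ ∀ τ : Equiv.Perm V, τ ≠ σB → (∀ i, ok i (τ i)) →
      ∑ i, (w i (τ i) + θB * g i (τ i)) < ∑ i, (w i (σB i) + θB * g i (σB i)))
    (hC : (∀ i, ok i (σC i)) ∧ ∀ τ : Equiv.Perm V, τ ≠ σC → (∀ i, ok i (τ i)) →
      ∑ i, (w i (τ i) + θC * g i (τ i)) < ∑ i, (w i (σC i) + θC * g i (σC i)))
    (hE : (∀ i, ok i (σE i)) ∧ ∀ τ : Equiv.Perm V, τ ≠ σE → (∀ i, ok i (τ i)) →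
      ∑ i, (w i (τ i) + θE * g i (τ i)) < ∑ i, (w i (σE i) + θE * g i (σE i)))
    (hB0 : σB (b 0) ≠ b 0) (hB1 : σB (b 1) = b 1) (hB2 : σB (b 2) = b 2) (hB3 : σB (b 3) ≠ b 3) (hB4 : σB (b 4) ≠ b 4)
    (hC0 : σC (b 0) ≠ b 0) (hC2 : σC (b 2) ≠ b 2) (hC3 : σC (b 3) = b 3) (hC4 : σC (b 4) ≠ b 4)
    (hE0 : σE (b 0) ≠ b 0) (hE1 : σE (b 1) ≠ b 1) (hE2 : σE (b 2) = b 2) (hE3 : σE (b 3) = b 3) (hE4 : σE (b 4) ≠ b 4)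
    (R : Equiv.Perm V) (hR : ∀ i, R i = σB i ∨ R i = σC i ∨ R i = σE i) : R = σB ∨ R = σC ∨ R = σE :=
  FourBit.no_third_cover ok w g hBC hCE hB hC hE
    (triangle_domination g b hb hoff hmark haux hB0 hB1 hB2 hB3 hB4 hC0 hC2 hC3 hC4 hE0 hE1 hE2 hE3 hE4) R hR

/-- **Relative form** (the `hT` hypothesis of `…MarkedEdgeCommonPath`): with `X = σB⁻¹σC`, `Y = σB⁻¹σE`, every permutation `ρ` with
`ρ i ∈ {i, X i, Y i}` for all `i` is `1`, `X` or `Y`. [this seat's lemma] -/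
theorem core_BCE_rigid_rel (hb : Function.Injective b)
    (hoff : ∀ i j, j ≠ i → g i j = 0) (hmark : ∀ l, g (b l) (b l) = (2 : ℤ) ^ (l : ℕ)) (haux : ∀ i, (∀ l, b l ≠ i) → g i i = 0)
    {θB θC θE : ℤ} {σB σC σE : Equiv.Perm V} (hBC : θB < θC) (hCE : θC < θE)
    (hB : (∀ i, ok i (σB i)) ∧ ∀ τ : Equiv.Perm V, τ ≠ σB → (∀ i, ok i (τ i)) →
      ∑ i, (w i (τ i) + θB * g i (τ i)) < ∑ i, (w i (σB i) + θB * g i (σB i)))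
    (hC : (∀ i, ok i (σC i)) ∧ ∀ τ : Equiv.Perm V, τ ≠ σC → (∀ i, ok i (τ i)) →
      ∑ i, (w i (τ i) + θC * g i (τ i)) < ∑ i, (w i (σC i) + θC * g i (σC i)))
    (hE : (∀ i, ok i (σE i)) ∧ ∀ τ : Equiv.Perm V, τ ≠ σE → (∀ i, ok i (τ i)) →
      ∑ i, (w i (τ i) + θE * g i (τ i)) < ∑ i, (w i (σE i) + θE * g i (σE i)))
    (hB0 : σB (b 0) ≠ b 0) (hB1 : σB (b 1) = b 1) (hB2 : σB (b 2) = b 2) (hB3 : σB (b 3) ≠ b 3) (hB4 : σB (b 4) ≠ b 4)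
    (hC0 : σC (b 0) ≠ b 0) (hC2 : σC (b 2) ≠ b 2) (hC3 : σC (b 3) = b 3) (hC4 : σC (b 4) ≠ b 4)
    (hE0 : σE (b 0) ≠ b 0) (hE1 : σE (b 1) ≠ b 1) (hE2 : σE (b 2) = b 2) (hE3 : σE (b 3) = b 3) (hE4 : σE (b 4) ≠ b 4)
    (ρ : Equiv.Perm V) (hρ : ∀ i, ρ i = i ∨ ρ i = (σB⁻¹ * σC) i ∨ ρ i = (σB⁻¹ * σE) i) :
    ρ = 1 ∨ ρ = σB⁻¹ * σC ∨ ρ = σB⁻¹ * σE := by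
  have hR : ∀ i, (σB * ρ) i = σB i ∨ (σB * ρ) i = σC i ∨ (σB * ρ) i = σE i := by
    intro i
    rcases hρ i with h | h | h <;> rw [Equiv.Perm.mul_apply, h]
    · exact Or.inl rfl
    · exact Or.inr (Or.inl (by simp))
    · exact Or.inr (Or.inr (by simp))
  rcases core_BCE_rigid ok w g b hb hoff hmark haux hBC hCE hB hC hE hB0 hB1 hB2 hB3 hB4 hC0 hC2 hC3 hC4 hE0 hE1 hE2 hE3 hE4
      (σB * ρ) hR with h | h | h
  · left; have := congrArg (fun τ => σB⁻¹ * τ) h; simpa using this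
  · right; left; have := congrArg (fun τ => σB⁻¹ * τ) h; simpa [mul_assoc] using this
  · right; right; have := congrArg (fun τ => σB⁻¹ * τ) h; simpa [mul_assoc] using this

end Core

end Core
end MarkedEdge
end Summit.ValiantsHypothesis.ValiantsHypothesis.Theorems.KPlusLogSqLaw
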